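import Summits.RiemannHypothesis.RiemannHypothesis.Theorems.LiTailLaguerreDefs
import Summits.RiemannHypothesis.RiemannHypothesis.Theorems.LiAsymptoticSmoothReplace
import Literature.Analysis.SpecialFunctions.LaguerreLaplaceTransform
import HarnessLib

/-!
# RiemannHypothesis / LiTailLaguerre — K2′ `LiPrimeTailLaguerre`, stub `stub_bridge_coffey`: BRIDGE ⇒ COFFEY TERM (RH-FREE)

RH-FREE [rh-li tail-p2].  Route `Theses/LiTailLaguerre.lean` (round 7 «Li TAIL–LAGUERRE LAW», rung L-P(P1-tail), cell
`pub/rh-li`, dossier `theory/route/r7/`), deciding crux K2′ `LiPrimeTailLaguerre` (stmt-RiemannHypothesis-19702), registered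
birth stub `stub_bridge_coffey` of `r7/bc/LiPrimeTailLaguerre_birth.lean` VERBATIM (with the skeleton's abbreviation
`bridgeInt n y := ∫_{(0,∞)} 2(1 − cos(nθ(t))) cos(ty) dt` unfolded):

  for `m ≥ 2`, `n ≥ 1`:  `(Λ(m)/(π√m)) · ∫_0^∞ 2(1 − cos(nθ(t))) cos(t log m) dt = liCoffeyTerm m n = (Λ(m)/m) L¹_{n−1}(log m)`,

`θ(t) = 2 arctan(1/(2t))` (`liZeroAngle`).  This is the arithmetic meaning of the LAGUERRE BRIDGE
`∫_0^∞ 2(1 − cos(nθ(t))) cos(ty) dt = π e^{−y/2} L¹_{n−1}(y)` (Literature theorem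
`Literature.Analysis.SpecialFunctions.integral_liKernel_mul_cos_Ioi`, Coffey 2010 eq. (122) via Fourier inversion): the
critical-line Li weight `2 − k_n(½+it) = 2(1 − cos nθ(t))` integrates the released prime power `m` (weight
`Λ(m) m^{−1/2} cos(t log m)/π`) to EXACTLY its Bombieri–Lagarias/Coffey term.

Contents (namespace `LiTheory.PrimeTail`):
* `liLaguerreOne_eq_laguerre_eval` — PART K's explicit polynomial `liLaguerreOne n` IS `L^{(1)}_{n−1}` (`laguerreCoeff_one`);
* `integral_bridge_eq` — the bridge in the column's vocabulary: `∫_0^∞ 2(1 − cos(nθ)) cos(ty) = π e^{−y/2} liLaguerreOne n y`;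
* `norm_bridgeIntegrand_le`, `integrableOn_bridgeIntegrand` — the integrand is `≤ 8(n+1)²/(1+t²)`, integrable on `(0,∞)`
  (so the `[0,T]` piece can be split off: `∫_0^∞ = ∫_0^T + ∫_T^∞`);
* `stub_bridge_coffey` — the registered stub.

Nothing here bears on the truth of RH.
-/

-- D-0017: `Summit.<S>.<S>.…` is the designed namespace of a single-problem summit.
set_option linter.dupNamespace false

open MeasureTheory Set
open scoped ArithmeticFunction.vonMangoldt

namespace Summit.RiemannHypothesis.RiemannHypothesis.Theorems.LiTheory

open Literature.Analysis.SpecialFunctions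

namespace PrimeTail

/-! ### The explicit polynomial of PART K is the associated Laguerre polynomial -/

/-- `liLaguerreOne n y = L^{(1)}_{n−1}(y)` for `n ≥ 1`: the binomial form of the `α = 1` Laguerre coefficients
(`laguerreCoeff_one`: `c_j(L^{(1)}_{n−1}) = (−1)^j C(n, j+1)/j!`). RH-free. -/
theorem liLaguerreOne_eq_laguerre_eval (n : ℕ) (hn : 1 ≤ n) (y : ℝ) :
    liLaguerreOne n y = (laguerre 1 (n - 1)).eval y := by
  obtain ⟨k, rfl⟩ : ∃ k, n = k + 1 := ⟨n - 1, by omega⟩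
  rw [Nat.add_sub_cancel, eval_laguerre]
  unfold liLaguerreOne
  refine Finset.sum_congr rfl fun j hj => ?_
  have hjk : j ≤ k := Nat.lt_succ_iff.mp (Finset.mem_range.mp hj)
  rw [laguerreCoeff_one k j hjk, neg_pow]
  ring

/-! ### The bridge in the column's vocabulary -/

/-- The LAGUERRE BRIDGE with `θ = liZeroAngle` and `L¹_{n−1} = liLaguerreOne n`: for `n ≥ 1` and `y > 0`,
`∫_0^∞ 2(1 − cos(nθ(t))) cos(ty) dt = π e^{−y/2} liLaguerreOne n y`
(`Literature.Analysis.SpecialFunctions.integral_liKernel_mul_cos_Ioi` at index `n − 1`). RH-free. -/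
theorem integral_bridge_eq (n : ℕ) (hn : 1 ≤ n) {y : ℝ} (hy : 0 < y) :
    ∫ t in Ioi (0 : ℝ), 2 * (1 - Real.cos (n * liZeroAngle t)) * Real.cos (t * y)
      = Real.pi * (Real.exp (-(y / 2)) * liLaguerreOne n y) := by
  obtain ⟨k, rfl⟩ : ∃ k, n = k + 1 := ⟨n - 1, by omega⟩
  have h := integral_liKernel_mul_cos_Ioi k hy
  rw [liLaguerreOne_eq_laguerre_eval (k + 1) hn, Nat.add_sub_cancel, ← h]
  refine setIntegral_congr_fun measurableSet_Ioi fun t _ => ?_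
  simp only [liZeroAngle]
  ring

/-! ### Integrability of the bridge integrand on `(0, ∞)` -/

/-- Pointwise majorant of the bridge integrand on `t > 0`:
`|2(1 − cos(nθ(t))) cos(ty)| ≤ 8(n+1)²/(1 + t²)` (`0 ≤ 1 − cos ≤ 2` and `1 − cos(nθ) ≤ n²/(2t²)`). RH-free. -/
theorem norm_bridgeIntegrand_le (n : ℕ) (y : ℝ) {t : ℝ} (ht : 0 < t) :
    ‖2 * (1 - Real.cos (n * liZeroAngle t)) * Real.cos (t * y)‖ ≤ 8 * ((n : ℝ) + 1) ^ 2 * (1 + t ^ 2)⁻¹ := by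
  have hw0 : 0 ≤ 1 - Real.cos (n * liZeroAngle t) := (SmoothReplace.liWindowWeight_mem n t).1
  have hw2 : 1 - Real.cos (n * liZeroAngle t) ≤ 2 := (SmoothReplace.liWindowWeight_mem n t).2
  have hwsq : 1 - Real.cos (n * liZeroAngle t) ≤ (n : ℝ) ^ 2 / (2 * t ^ 2) :=
    SmoothReplace.liWindowWeight_le_sq n ht
  have hcos : |Real.cos (t * y)| ≤ 1 := Real.abs_cos_le_one _
  rw [Real.norm_eq_abs, abs_mul, abs_of_nonneg (by positivity : (0 : ℝ) ≤ 2 * (1 - Real.cos (n * liZeroAngle t)))]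
  have hpos : 0 < 1 + t ^ 2 := by positivity
  have hn : (0 : ℝ) ≤ n := n.cast_nonneg
  have hn1 : (1 : ℝ) ≤ ((n : ℝ) + 1) ^ 2 := by nlinarith
  calc 2 * (1 - Real.cos (n * liZeroAngle t)) * |Real.cos (t * y)|
      ≤ 2 * (1 - Real.cos (n * liZeroAngle t)) * 1 :=
        mul_le_mul_of_nonneg_left hcos (by positivity)
    _ ≤ 8 * ((n : ℝ) + 1) ^ 2 * (1 + t ^ 2)⁻¹ := by
        rw [mul_one, ← div_eq_mul_inv, le_div_iff₀ hpos]
        rcases le_or_gt t 1 with h1 | h1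
        · -- `t ≤ 1`: use `1 − cos ≤ 2` and `1 + t² ≤ 2`
          have ht2 : 1 + t ^ 2 ≤ 2 := by nlinarith
          have h3 : (1 - Real.cos (n * liZeroAngle t)) * (1 + t ^ 2) ≤ 2 * 2 :=
            mul_le_mul hw2 ht2 hpos.le (by norm_num)
          nlinarith
        · -- `t > 1`: use `1 − cos ≤ n²/(2t²)` and `1 + t² ≤ 2t²`
          have ht2 : 0 < t ^ 2 := by positivity
          have h3 : 2 * (1 - Real.cos (n * liZeroAngle t)) ≤ (n : ℝ) ^ 2 / t ^ 2 := by
            rw [le_div_iff₀ ht2]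
            have := mul_le_mul_of_nonneg_right hwsq (by positivity : (0 : ℝ) ≤ 2 * t ^ 2)
            rw [div_mul_cancel₀ _ (by positivity : (2 : ℝ) * t ^ 2 ≠ 0)] at this
            linarith
          have h4 : (n : ℝ) ^ 2 / t ^ 2 * (1 + t ^ 2) ≤ 2 * (n : ℝ) ^ 2 := by
            rw [div_mul_eq_mul_div, div_le_iff₀ ht2]
            have : 1 + t ^ 2 ≤ 2 * t ^ 2 := by nlinarith
            nlinarith [sq_nonneg (n : ℝ)]
          have h5 : 2 * (1 - Real.cos (n * liZeroAngle t)) * (1 + t ^ 2) ≤ (n : ℝ) ^ 2 / t ^ 2 * (1 + t ^ 2) :=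
            mul_le_mul_of_nonneg_right h3 hpos.le
          nlinarith

/-- The bridge integrand `2(1 − cos(nθ(t))) cos(ty)` is integrable on `(0, ∞)` (majorant `8(n+1)²/(1+t²)`), so that
`∫_0^∞ = ∫_0^T + ∫_T^∞` is legitimate. RH-free. -/
theorem integrableOn_bridgeIntegrand (n : ℕ) (y : ℝ) :
    IntegrableOn (fun t : ℝ => 2 * (1 - Real.cos (n * liZeroAngle t)) * Real.cos (t * y)) (Ioi 0) := by
  have hmaj : IntegrableOn (fun t : ℝ => 8 * ((n : ℝ) + 1) ^ 2 * (1 + t ^ 2)⁻¹) (Ioi 0) :=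
    (integrable_inv_one_add_sq.const_mul (8 * ((n : ℝ) + 1) ^ 2)).integrableOn
  refine Integrable.mono' hmaj ?_ ?_
  · refine ContinuousOn.aestronglyMeasurable ?_ measurableSet_Ioi
    have hθ : ContinuousOn liZeroAngle (Ioi 0) := by
      unfold liZeroAngle
      refine ContinuousOn.mul continuousOn_const ((Real.continuous_arctan).comp_continuousOn ?_)
      exact continuousOn_const.div (continuousOn_const.mul continuousOn_id) fun t ht => by
        have : (0 : ℝ) < t := ht
        positivity
    fun_prop (disch := assumption)
  · rw [ae_restrict_iff' measurableSet_Ioi]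
    exact Filter.Eventually.of_forall fun t ht => norm_bridgeIntegrand_le n y ht

/-! ### The registered stub -/

/-- **Registered stub `stub_bridge_coffey` of K2′ `LiPrimeTailLaguerre` (Sig VERBATIM, `bridgeInt` unfolded): BRIDGE ⇒ COFFEY
TERM.**  For `m ≥ 2` and `n ≥ 1`,
`(Λ(m)/(π√m)) · ∫_0^∞ 2(1 − cos(nθ(t))) cos(t log m) dt = liCoffeyTerm m n = (Λ(m)/m) L¹_{n−1}(log m)`:
the bridge at `y = log m > 0`, `e^{−(log m)/2} = 1/√m` and `√m · √m = m`. RH-free; nothing here bears on RH. -/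
theorem stub_bridge_coffey (m n : ℕ) (hm : 2 ≤ m) (hn : 1 ≤ n) :
    (Λ m : ℝ) / (Real.pi * Real.sqrt m) *
        (∫ t in Set.Ioi (0 : ℝ), 2 * (1 - Real.cos (n * liZeroAngle t)) * Real.cos (t * Real.log m))
      = liCoffeyTerm m n := by
  have hm0 : (0 : ℝ) < m := by exact_mod_cast (show 0 < m by omega)
  have hlog : 0 < Real.log m := Real.log_pos (by exact_mod_cast (show 1 < m by omega))
  rw [integral_bridge_eq n hn hlog, liCoffeyTerm]
  have hexp : Real.exp (-(Real.log m / 2)) = (Real.sqrt m)⁻¹ := by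
    rw [Real.sqrt_eq_rpow, ← Real.rpow_neg hm0.le, Real.rpow_def_of_pos hm0]
    congr 1
    ring
  rw [hexp]
  have hpi : Real.pi ≠ 0 := Real.pi_ne_zero
  calc (Λ m : ℝ) / (Real.pi * Real.sqrt m) * (Real.pi * ((Real.sqrt m)⁻¹ * liLaguerreOne n (Real.log m)))
      = (Λ m : ℝ) * liLaguerreOne n (Real.log m) * (Real.pi / Real.pi) * ((Real.sqrt m)⁻¹ * (Real.sqrt m)⁻¹) := by
        ring
    _ = (Λ m : ℝ) * liLaguerreOne n (Real.log m) * ((Real.sqrt m)⁻¹ * (Real.sqrt m)⁻¹) := by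
        rw [div_self hpi, mul_one]
    _ = (Λ m : ℝ) / m * liLaguerreOne n (Real.log m) := by
        rw [← mul_inv, Real.mul_self_sqrt hm0.le]
        ring

end PrimeTail

end Summit.RiemannHypothesis.RiemannHypothesis.Theorems.LiTheory
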